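import Mathlib
import HarnessLib
import HarnessLib.Audit
import Summits.PneNP.Statement
import Literature.Probability.RandomGraphs.PlantedClique
import Literature.Probability.RandomGraphs.LowDegree
import Literature.Computability.Complexity.Randomized
import HarnessLib.Audit.Status.Attr

/-!
Route: PlantedClique

DORMANT since 2026-08-22T01:31:39Z (reconciler: no traction for 5 d (last activity item-proof-filed at 2026-08-17T00:42:53Z); parked, not closed — `ledger route dormant route-PneNP-PlantedClique --off` to reactivate) — unstaffed, not closed; items shared with open routes are served there. `ledger route dormant <id> --off` reactivates.

# Route PlantedClique — the Planted Clique conjecture below √n decides P ≠ NP; mechanism: low-degree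
hardness of the clique family (statistics)

It suffices to show X = PlantedcliqueDetectionHard, the Planted Clique conjecture in its
STRONG-DETECTION form (BarakHopkinsKelnerKothariMoitraPotechin2019 §1 Rem. 2; Jerrum1992 §5): for
every ε > 0, no probabilistic polynomial-time test T has Pr_{G∼G(n,1/2)}[T accepts] +
Pr_{G∼G(n,1/2,⌈n^{1/2−ε}⌉)}[T rejects] → 0, where G(n,1/2,k) = `plantedCliqueDist n k` plants a
clique on a uniformly random k-subset of G(n,1/2) (vocabulary of
Literature/Probability/RandomGraphs/PlantedClique.lean). X is the weakest of the three classical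
forms the route carries and the one the deciding theorem consumes. The OPERATIVE crux is the
weak-detection form PlantedcliqueIndistinguishable (Brennan–Bresler–Huleihel, arXiv:1806.07508 Conj.
2.1 at p = 1/2: advantage → 0 at every clique-size sequence k(n) ≤ n^{1/2−ε}), which yields X
(support PlantedcliqueDetectionGlue) and the search form PlantedcliqueThesis = the Jerrum–Kučera
recovery conjecture (support PlantedcliqueRecoveryGlue; kept as the route's `target` and negated as
the kill item PlantedcliqueNegAlgorithm). The MECHANISM crux (rank 2) is the
low-degree-to-polynomial-time transfer for the planted-clique family alone,
PlantedcliqueLowDegreePrediction, which together with the provable calculation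
PlantedcliqueLowDegreeNormOne gives PlantedcliqueIndistinguishable (support
PlantedcliqueIndistinguishableGlue).
Lean: `∀ ε : ℝ, 0 < ε → Literature.Probability.RandomGraphs.PlantedClique.PlantedCliqueDetectionHard
(fun n : ℕ => ⌈(n : ℝ) ^ (1 / 2 - ε)⌉₊)`

## Assembly
CRUX-ONLY RULE (gate, 2026-08-16; needs_repair glue.non-crux-hypothesis): the certified deciding
theorem below takes, besides the crux PlantedcliqueDetectionHard, two PROVABLE-NOW non-crux premises
— hE : ErdosRenyiNoLargeClique (support, stmt-PneNP-8686, S/M: first-moment clique bound through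
toOuterMeasure_forall_eq_true_le + union bound) and hA : Assembly2 (assembly-kind, stmt-PneNP-8690,
M: Karp's CLIQUE ∈ NP via the proved CLIQUE_mem_NP + Clay bridges P_bool_eq_holds/NP_bool_eq_holds +
an FP re-encoding). Under the crux-only rule these two are GLUE OBLIGATIONS to be proved first (they
are served to provers as such; they are this route's first concrete work and neither is a research
obstruction, so neither may be re-badged crux); once both have landed
(`ErdosRenyiNoLargeClique_holds`, `Assembly2_holds` appended by the gate), the deciding theorem is
re-filed crux-only as `theorem closes (hD : PlantedcliqueDetectionHard) : PneNP := <the four lines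
below with hE := ErdosRenyiNoLargeClique_holds, hA := Assembly2_holds>` (`ledger route edit
--closes-file`; the gate's backfill (i) may do it automatically). Until then the stamp stands by
design; nothing else in the route depends on it.
Deciding theorem (D-0027 §2.1, certified by the native audit — conclusion PneNP by name, hypotheses
⊆ items, axioms {propext, Classical.choice, Quot.sound}): `theorem closes (hE :
ErdosRenyiNoLargeClique) (hD : PlantedcliqueDetectionHard) (hA : Assembly2) : PneNP` — four lines of
classical logic (by_contra: if ¬PneNP then every L ∈ PNPWave0.NP Bool lies in PNPWave0.P Bool, and
Assembly2 turns that inclusion, with the first-moment bound, into ¬PlantedcliqueDetectionHard). All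
mathematics sits in the two PROVABLE-NOW premises: ErdosRenyiNoLargeClique (ω(G(n,1/2)) < (2+η)·log₂
n w.h.p.; engine toOuterMeasure_forall_eq_true_le of PlantedCliqueUnique.lean + union bound; S/M)
and Assembly2 = ErdosRenyiNoLargeClique → (NP ⊆ P over the Wave0 classes) →
¬PlantedcliqueDetectionHard (M; Karp1972: CLIQUE ∈ NP is the PROVED tree theorem CLIQUE_mem_NP of
KarpCliqueNP.lean, so with the Clay bridges P_bool_eq_holds / NP_bool_eq_holds and an FP re-encoding
of boolPair 1ⁿ (encodeEdgeVec x) into the KarpCliqueNP instance code one gets a polynomial-time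
Boolean decider g of "graphOfEdgeVec x has a clique of size t(n) := (Nat.size n)²"; the coin-free
test RandAlg.ofDet g (PPT by RandAlg.IsPolyTime.ofDet_holds) has type-II error 0 at k = ⌈n^{1/4}⌉
eventually (the planted clique contains a t(n)-clique surely, mem_support_plantedCliqueJoint) and
type-I error → 0 by ErdosRenyiNoLargeClique at k := t, contradicting PlantedcliqueDetectionHard at ε
= 1/4; no search-to-decision, no uniqueness). Route DAG: PlantedcliqueLowDegreePrediction ∧
PlantedcliqueLowDegreeNormOne → PlantedcliqueIndistinguishable → {PlantedcliqueDetectionHard → PneNP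
(closes); PlantedcliqueThesis (target, via PlantedcliqueRecoveryGlue)}. RESIDUAL SHAPE DEBT
(operator/tenure authority needed; confirmed again by this g4 seat with the exact bounces: `--drop
Assembly` → "the assembly item cannot be dropped (restate it)", retriage of Assembly2 → "the
assembly item cannot be retriaged", `--restate Assembly := ErdosRenyiNoLargeClique →
PlantedcliqueDetectionHard → Assembly2 → PneNP` → "route.multi-assembly: 2 assembly items"): the
route carries two assembly-kind items — Assembly2 (stmt-PneNP-8690, auto-labelled assembly at filing
because its first signature concluded in PneNP; it is the NP-membership plumbing and the third
premise of `closes`, i.e. a provable-now support) and the legacy Assembly (stmt-PneNP-0421: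
LowDegreePrediction → Indistinguishable → Thesis → PneNP, redundant — with Indistinguishable among
its own hypotheses it follows from the detection chain via PlantedcliqueDetectionGlue + Assembly2 +
ErdosRenyiNoLargeClique, so it costs provers nothing extra). The one-command clean-ups are attached
to the route as evidence for whoever holds the authority: edit-g3-B1.json (re-kind 8690 → support,
restate Assembly := ErdosRenyiNoLargeClique → PlantedcliqueDetectionHard → Assembly2 → PneNP = the
type of `closes`, provable by `exact closes`; drop stmt-PneNP-0422) or edit9.json / edit-g3-B.json
(positive variants). None of this blocks staffing: the deciding theorem is certified and the
constant cone has 0 unproved dependencies. IMPORT CONE (this revision): no item mentions a constant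
of Literature.Computability.Cryptography.OneWayFunctions any more, so that module — home of the four
open conjectures OWFExist / WeakOWFExist / NonuniformOWFExist / IOOWFExist, which rode into the
file-level import cone on the readability abbreviation IsPPT and kept the priority module from
seating provers — is no longer imported: the PPT hypothesis of the cruxes
PlantedcliqueLowDegreePrediction / PlantedcliqueIndistinguishable is spelled `T.IsPolyTime id (fun b
=> [b])` (IsPPT is an `abbrev` for exactly this; PlantedClique.lean's own hardness predicates use
the same spelling, cone note of item defn-BernoulliVecStandalone), and the crypto dictionary
PlantedcliqueImpliesOwf (Thesis ⇒ one-way functions exist; Juels–Peinado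
doi:10.1023/A:1008374125234; an informative support rung OFF the deciding path, with the tree's
pneNP_shape_of_OWFExist a third, harder path to P ≠ NP) states `∃ f, IsOneWay f` (= OWFExist) with
IsOneWay, invertProb and uniformAvg unfolded to Goldreich's Def. 2.2.1 (f polynomial-time computable
and, for every PPT inverter A, n ↦ 2⁻ⁿ·Σ_{x ∈ {0,1}ⁿ} Pr[A(1ⁿ, f x) ∈ f⁻¹(f x)] of superpolynomial
decay, the average written as a finite sum over List.Vector Bool n), so that neither
OneWayFunctions.lean nor StatisticalDistance.lean (whose named fact IsStatisticallyClose.trans is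
undischarged) is imported; imports = PlantedClique, LowDegree, Randomized — the vocabulary of the
Literature topic itself. All three respellings are DEFINITIONALLY the previously filed statements
(`Iff.rfl`, Sketch.lean attached as evidence), so no stamp or refuter finding (crux-attack on
stmt-PneNP-8683, 2026-08-16: survives) changes meaning. The informal-only legacy item
stmt-PneNP-0422 (general Sₙ-invariant noise-free transfer, false as worded: edge parity, #edges mod
⌈log n⌉) is inert support text superseded by the typed clique-family crux; its drop waits for the
same authority.

Rationale: WHY THIS LINE. Planted clique is the average-case problem with the richest UNCONDITIONAL theory in
restricted models — the Metropolis process fails below n^{1/2} (Jerrum1992), statistical-query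
algorithms fail (arXiv:1201.1214), degree-d Sum-of-Squares fails for k ≤ n^{1/2 − c(d/log n)^{1/2}}
(BarakHopkinsKelnerKothariMoitraPotechin2019 = arXiv:1604.03084), polynomials of degree o((log n/log
log n)²) fail to separate (arXiv:2506.10748 Thm 1; Hopkins2018 §2.4) — while spectral recovery
succeeds exactly from k ≥ c√n (AlonKrivelevichSudakov1998, PROVED in the tree as aks_recovery_holds
/ aks_unique_holds). What is imported, and from where: from mathematical statistics, the low-degree
likelihood ratio (Le Cam contiguity and the second-moment method made computational: Hopkins2018,
KuniskyWeinBandeira2019 = arXiv:1907.11636), which turns "is there a polynomial-time test" into an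
orthogonal-polynomial (Fourier–Walsh) computation under the product measure G(n,1/2); that
computation is the support PlantedcliqueLowDegreeNormOne and is provable now (a port of the tree's
Bernoulli-model theorem hopkins_lowDegree_bounded_holds), so the entire conjectural content of the
mechanism is isolated in ONE transfer statement for ONE family (PlantedcliqueLowDegreePrediction).
The route runs in the unobstructed direction average-case hardness ⇒ worst-case hardness (no
Bogdanov–Trevisan / Akavia–Goldreich–Goldwasser–Moshkovitz obstruction applies), and its deciding
chain PlantedcliqueDetectionHard → PneNP needs only Karp's NP-membership of threshold-CLIQUE
(Karp1972) and the first-moment clique bound, both formalisable against the tree's FinTM2/CodeFP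
toolkit exactly as the AKS program was (PlantedCliqueProgramFP, RandAlg.IsPolyTime.ofDet_holds).
Versus the sibling planted route Kloosterman (number-theoretic weak-OWF candidate) and the MetaCplx
/ Lattice / Feige routes, this is the combinatorial-statistics candidate with a typed mechanism
crux; the negatives index (5 refuted PneNP statements) is untouched by it.

RANKED CRUXES. #2 PlantedcliqueLowDegreePrediction (crux) — low-degree-to-polynomial-time transfer
for the planted-clique family, contiguity form: for any clique-size sequence k, if
lowDegreeLRSq(plantedCliqueDist n (k n), ⌈(log n)^{1+δ}⌉) → 1 for some δ > 0 then every PPT test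
(spelled `T.IsPolyTime id (fun b => [b])`) has type-I + type-II error ≥ 1 − o(1); the refuter's
crux-attack (2026-08-16, survives) computed the exact window of the hypothesis — it holds iff k ≤
√n·2^{−Θ((ln n)^{(1+δ)/2}·polyloglog n)}, fails at k = c√n and k = √n/polylog — and notes that with
the provable NormOne the crux is a strengthening of #3 on that larger window, i.e. the transfer has
no separately provable content: rank 2 is deserved (why it might fail: noise-free transfer is false
for general Sₙ-invariant graph laws — edge parity, #edges mod ⌈log n⌉ — and even the noisy
quasi-polynomial conjecture fails for graphs, arXiv:2505.17360; the bet is the clique family alone)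
[Hopkins2018, KuniskyWeinBandeira2019, arXiv:2506.10748, arXiv:2505.17360, HolmgrenWein2021]. #3
PlantedcliqueDetectionHard (crux; PREMISE OF `closes`) — the strong-detection Planted Clique
conjecture at k = ⌈n^{1/2−ε}⌉ for every ε > 0 (why it might fail: dies if ONE PPT test strongly
detects for ONE ε; only restricted classes provably fail below √n and no worst-case assumption is
known to imply it, BHKKMP §1) [BarakHopkinsKelnerKothariMoitraPotechin2019, Jerrum1992, Kucera1995,
AlonKrivelevichSudakov1998, FeigeKrauthgamer2003, arXiv:1201.1214]. #3
PlantedcliqueIndistinguishable (crux; the operative form) — weak-detection Planted Clique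
conjecture, arXiv:1806.07508 Conj. 2.1 at p = 1/2, for every admissible k(n) ≤ n^{1/2−ε}; implies
DetectionHard (PlantedcliqueDetectionGlue) and the target (PlantedcliqueRecoveryGlue) (why it might
fail: one statistic with advantage ↛ 0 at one admissible k kills it; spectral/degree statistics need
k = Ω(√n)) [arXiv:1806.07508, BarakHopkinsKelnerKothariMoitraPotechin2019,
AlonKrivelevichSudakov1998]. Target #0 PlantedcliqueThesis — the Jerrum–Kučera recovery conjecture
(∀ ε > 0, every PPT algorithm recovers the planted ⌈n^{1/2−ε}⌉-set with probability → 0); its kill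
boundary is PROVED in the tree (aks_recovery.not_recoveryHard for k ≥ c√n) [Jerrum1992, Kucera1995,
AlonKrivelevichSudakov1998]. Supports (rank 9): PlantedcliqueLowDegreeNormOne (the calculation, δ =
1/2 works; provable now, M), ErdosRenyiNoLargeClique (first moment; provable now, S/M; premise of
`closes`), PlantedcliqueUniqueClique (provable now, S), PlantedcliqueIndistinguishableGlue (logic),
PlantedcliqueDetectionGlue (S: ⌈n^{1/2−ε}⌉₊ ≤ n^{1/2−min(ε/2,1/4)} eventually, then η = 1/2),
PlantedcliqueRecoveryGlue (a recovery algorithm plus a clique check is a test; M), Assembly2 (kind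
assembly: ErdosRenyiNoLargeClique → (NP ⊆ P, Wave0 classes) → ¬PlantedcliqueDetectionHard; M, via
the proved CLIQUE_mem_NP + Clay bridges + an FP re-encoding; premise of `closes`), Assembly (legacy
assembly-kind item LowDegreePrediction → Indistinguishable → Thesis → PneNP; redundant, follows from
the detection chain; kept only because a seat can neither drop nor re-badge an assembly item and any
restate bounces on route.multi-assembly — see the thesis' residual-debt note and evidence
edit-g3-B1.json), PlantedcliqueImpliesOwf (crypto dictionary Thesis ⇒ ∃ f, IsOneWay f, i.e.
OWFExist, spelled with IsOneWay/invertProb/uniformAvg unfolded to Goldreich Def. 2.2.1 so that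
OneWayFunctions.lean with its four open-conjecture constants, and StatisticalDistance.lean, stay out
of the import cone; L — weak one-wayness of (coins, S) ↦ G(n,1/2) ∪ K_S from recovery hardness needs
near-uniform k-subset sampling from coins plus uniqueness, and the strong form a Yao-type
amplification; informative rung, not a premise), PlantedcliqueNegAlgorithm (¬Thesis, the kill side).

KILL CRITERIA. PlantedcliqueDetectionHard refuted (a PPT strong test at some ε > 0) or
PlantedcliqueNegAlgorithm proved (a PPT recovery algorithm at some k = n^{1/2−ε}) closes the route
`refuted` — and breaks the √n barrier, to be recorded as a Literature fact.
PlantedcliqueLowDegreePrediction refuted by a counterexample INSIDE the clique family → pivot, not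
death: drop the mechanism crux and either re-file the route as an explicit conditional bridge on
arXiv:1806.07508 Conj. 2.1 or close it `superseded` in favour of whichever average-case route then
carries a live mechanism. Assembly2, ErdosRenyiNoLargeClique or a glue support refuted can only mean
a misstatement (encoding corner, t(n) = (Nat.size n)² threshold, k > n junk case) and is repaired by
a restated item, never by closing.

NOT DECOMPOSED YET. FIRST WORK (crux-only rule): prove the two glue obligations of `closes` —
ErdosRenyiNoLargeClique (stmt-PneNP-8686) and Assembly2 (stmt-PneNP-8690) — then re-file `closes`
with the single binder PlantedcliqueDetectionHard. The FP re-encoding (upper-triangular edge list ↦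
KarpCliqueNP instance code) and the evaluation of typeIError/typeIIError for a coin-free test inside
Assembly2, and the FP realisation of the clique check inside PlantedcliqueRecoveryGlue are
prover-level lemmas (`--supports`), not items. The search-form reduction (UniqueClique → Thesis →
PneNP via exists_searchFn_of_NP_subset_P) is a tenure option for a second deciding path, not an
item. No split of #2 is filed before someone proposes a proof strategy for transfer restricted to
cliques (none exists in print; the natural first child would be "transfer against tests that are
themselves low-degree-approximable", which is circular until a class is named). The
success-probability threshold of the target (→ 0 vs ≤ 1 − 1/poly) matters only for
PlantedcliqueImpliesOwf and stays there. Reductions FROM planted clique (sparse PCA, community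
detection, arXiv:1806.07508) are consequences, not cruxes.

CHEAPEST FALSIFIER. For the line: exhibit one polynomial-time statistic with non-vanishing advantage
between G(n,1/2) and G(n,1/2,⌈n^{1/2−ε}⌉) for one ε > 0 — edge count / max degree, triangle count
and top adjacency eigenvalue are the three to run first, and all three are known to need k = Ω(√n)
(Kucera1995; AlonKrivelevichSudakov1998 §1–2); a `kit` Monte-Carlo of their advantage at n ≤ 4000, k
= n^{0.45} vs n^{0.5} is the one-hour version. For the mechanism crux #2: a clique-family instance
of the Holmgren–Wein / arXiv:2505.17360 phenomenon, i.e. a k-sequence with lowDegreeLRSq → 1 at D =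
(log n)^{1+δ} yet a poly-time distinguisher — the place to look is k(n) = o(√n) above n^{1/2−o(1)}
(e.g. √n/polylog n), where the D = (log n)^{1+δ} norm is borderline (the n^{−εt} summation of
PlantedcliqueLowDegreeNormOne no longer applies) while every known poly-time statistic still
provably fails. For the provable premises: `lean check` of ErdosRenyiNoLargeClique at k = 3⌈log₂ n⌉
through the existing engine; a failure there signals a misstatement only.

Novelty: Searches (2026-08-15, two repair passes): `lit frontier PneNP --since 2021` (30 rows: proof
complexity / meta-complexity, none on planted clique); `lit search --source arxiv "planted clique
detection polynomial time algorithm below sqrt n" --year-from 2020` (2: arXiv:2004.12002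
sublinear-time finding for k ≫ √n; arXiv:2604.07278 SoS/SQ lower bounds for several planted
structures below √n — consistent); `lit galaxy search "hidden clique" --star pdf` (10: Bresler–Jiang
COLT 2023 detection-recovery gaps via reductions FROM the PC conjectures, Gamarnik–Zadik
arXiv:1904.07174 OGP landscape, Potechin SoS notes); `lit read` of arXiv:1907.11636 (Conj. 1 p. 7,
§4.2.1, §4.2.4–5), arXiv:1604.03084 (Rem. 1.2), arXiv:1806.07508 (Conj. 2.1 p. 11), arXiv:2505.17360
(abstract, Conj. 1.2, Thm 1.3: the quasi-polynomial low-degree conjecture is false for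
permutation-invariant planting in {0,1}^{C(n,k)}, distinguisher time n^{O(log^{1/(k−1)} n)}),
arXiv:2506.10748 (§2 pp. 9–10; Thm 1 p. 10: for k = Θ(n^a), a < 1/2, D = o((log n/log log n)²), no
degree-D polynomial weakly separates the binomial planted-clique model from G(n,1/2)); tree search
(`lean search`) found the relevant PROVED infrastructure: aks_recovery_holds / aks_unique_holds
(PlantedCliqueFactsProofs), hopkins_lowDegree_bounded_holds (PlantedCliqueLowDegreeProofs),
exists_searchFn_of_NP_subset_P (SearchToDecision), pneNP_shape_of_OWFExist /
pneNP_shape_of_WeakOWFExist (OneWayFunctionsPneNP), P_bool_eq_holds / NP_bool_eq_holds (ClayPro  [refs: 10.1023/A:1008374125234, 2004.12002, 2604.07278, 1904.07174, 1907.11636, 1604.03084, 1806.07508, 2505.17360, 2506.10748, doi:10.1023/A, Hopkins2018, KuniskyWeinBandeira2019, BarakHopkinsKelnerKothariMoitraPotechin2019, HolmgrenWein2021]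

Barriers (technique_class: low-degree-method, planted-clique, average-case-hardness): - technique_class: low-degree-method, planted-clique, average-case-hardness
(statistical-computational gaps; conditional line)
- Literature.Barriers.PneNP.LowDegreeCounterexamples: bears on rank 2's technique class
(low-degree-to-polynomial-time transfer). Formally evaded: the crux is the Sₙ-invariant Boolean
CLIQUE family, outside Thm 2 (symmetry dropped) and Thm 1 (real-valued data) — the entry's
scope_caveats say the symmetric finite-alphabet case "stands". Conceded: the crux drops the noise
operator and uses the contiguity (weak-detection) conclusion; the general noise-free symmetric
statement is false (G(n,1/2) conditioned on #edges ≡ 0 mod ⌈log n⌉; edge parity) and even the noisy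
QUASI-POLYNOMIAL conjecture fails for permutation-invariant planting on {0,1}^{C(n,k)}
(arXiv:2505.17360 Thm 1.3, distinguisher time n^{O(log^{1/(k−1)} n)} — not polynomial, so the
polynomial-time/degree-(log n)^{1+δ} form filed here is not hit; not yet catalogued); the bet is
specifically that cliques carry no brittle algebraic or coding-theoretic structure (the
counterexamples use list-decoding of noisy polynomial interpolation) for a non-robust algorithm to
exploit.
- Literature.Barriers.PneNP.NPHardnessToOneWayFunctions: it does not evade, it explains the
direction of the route — non-adaptive worst-case-to-average-case reductions cannot base the cruxes
(or the dictionary's one-way function, PlantedcliqueImpliesOwf) on NP-hardness unless coNP ⊆ AM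
(Bogdanov–Trevisan / Akavia–Goldreich–Goldwa

History (route lifecycle, newest last):
- 2026-08-16T14:43:06Z · LINT AUTOFIX route.multi-assembly: kept Assembly2, dropped Assembly (gate:hygiene)
- 2026-08-22T01:31:39Z · DORMANT — reconciler: no traction for 5 d (last activity item-proof-filed at 2026-08-17T00:42:53Z); parked, not closed — `ledger route dormant route-PneNP-PlantedClique - (operator:999:3728207)

sub-problem: PneNP · status: dormant · opened planner-PneNP-Survey-0 2026-08-13T06:33:40Z · rev 8 · ledger route-PneNP-PlantedClique
GENERATED by the gate from the ledger (D-0016/17). Provers cite these decls: `theorem foo : Summit.PneNP.PneNP.Theses.PlantedClique.<Decl> := …` in Summits/PneNP/PneNP/Theorems/<Name>.lean.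
-/

namespace Summit.PneNP.PneNP.Theses.PlantedClique

open scoped BigOperators Topology Manifold Classical MeasureTheory ProbabilityTheory Matrix InnerProductSpace ComplexConjugate ContinuousMap
open Filter Set Function TopologicalSpace MeasureTheory

attribute [summit_statement] _root_.PneNP

open Literature.PNP

/-- item stmt-PneNP-0420 · target · rank 0 · open · by planner
why it might fail: Search PC conjecture: false if ONE PPT algorithm outputs the planted ⌈n^{1/2−ε}⌉-clique with probability ↛ 0 for ONE ε; recovery is known for k ≥ c√n, every c > 0 (AKS98 §2; tree aks_recovery_holds) and k ≥ √(n/e) (arXiv:1304.7047); nothing is excluded below √n for general algorithms.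
sources: Jerrum1992, Kucera1995, AlonKrivelevichSudakov1998, BarakHopkinsKelnerKothariMoitraPotechin2019, arXiv:1304.7047, arXiv:2506.10748
Route thesis of PneNP/PlantedClique (informal until plantedCliqueDist lands). For every ε > 0 and
every randomized polynomial-time algorithm A: with S a uniformly random subset of Fin n of size
⌈n^{1/2−ε}⌉ and G = G(n,1/2) ∪ K_S (each non-S-pair an edge independently w.p. 1/2, all pairs inside
S edges), Pr[A(G) = S] → 0 as n → ∞. [Jerrum1992; Kucera1995; arXiv:1604.03084, Conj. in §1 (bib
keys missing except arXiv)] NEEDS DEFINITION: plantedCliqueDist. [sources: Jerrum1992; Kucera1995;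
arXiv:1604.03084] [route PneNP/PlantedClique, rank 0] -/
@[route_item "route-PneNP-PlantedClique"]
def PlantedcliqueThesis : Prop :=
  ∀ ε : ℝ, 0 < ε → Literature.Probability.RandomGraphs.PlantedClique.PlantedCliqueRecoveryHard (fun n : ℕ => ⌈(n : ℝ) ^ (1 / 2 - ε)⌉₊)

/-- item stmt-PneNP-8683 · crux · rank 2 · open · by planner
why it might fail: Noise-free transfer is false for general Sₙ-invariant graph laws (edge parity; #edges mod ⌈log n⌉) and the noisy quasi-poly form fails for graphs (arXiv:2505.17360 Thm 1.3); the hypothesis holds up to k = √n·2^{−Θ((ln n)^{(1+δ)/2})}, so ONE poly-time test anywhere in that window below c√n kills it.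
sources: Hopkins2018, KuniskyWeinBandeira2019, arXiv:1907.11636, arXiv:2506.10748, arXiv:2505.17360, HolmgrenWein2021
[crux] Low-degree prediction for the PLANTED-CLIQUE FAMILY, contiguity (weak-detection) form: for
every clique-size sequence k, if for some δ > 0 the squared degree-⌈(log n)^{1+δ}⌉ low-degree
likelihood-ratio norm of G(n,1/2,k n) = plantedCliqueDist n (k n) against G(n,1/2) tends to 1, then
no probabilistic polynomial-time test has non-vanishing advantage: liminf (type-I + type-II error) ≥
1, i.e. ∀ η > 0 eventually typeIError T n + typeIIError T k n ≥ 1 − η. This is the computational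
analogue of the second-moment method for contiguity that KuniskyWeinBandeira2019 (arXiv:1907.11636,
Conj. 1, PDF p. 7: 'bounded ⇒ no strong detection') describe and that Wein's survey states as the
working heuristic (arXiv:2506.10748 §2, PDF pp. 9–10: 'to argue that poly-time algorithms cannot
achieve strong (or weak) detection, we will aim to rule out strong (respectively, weak) separation
by degree-D polynomials for some D = ω(log n)'; Thm 1, p. 10: for k = Θ(n^a), a < 1/2, no
degree-o((log n/log log n)²) polynomial weakly separates the binomial planted-clique model from
G(n,1/2)), instantiated at ONE sequence meeting the niceness conditions of Hopkins2018 Conj. 2.2.4 /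
arXiv:2505.17360 Conj. 1.2 (p -/
@[route_item "route-PneNP-PlantedClique"]
def PlantedcliqueLowDegreePrediction : Prop :=
  ∀ k : ℕ → ℕ, (∃ δ : ℝ, 0 < δ ∧ Filter.Tendsto (fun n : ℕ => Literature.Probability.RandomGraphs.LowDegree.lowDegreeLRSq (Literature.Probability.RandomGraphs.PlantedClique.plantedCliqueDist n (k n)) ⌈Real.log (n : ℝ) ^ (1 + δ)⌉₊) Filter.atTop (nhds 1)) → ∀ T : Literature.Computability.Complexity.RandAlg (List Bool) Bool, T.IsPolyTime id (fun b => [b]) → ∀ η : ℝ, 0 < η → ∀ᶠ n : ℕ in Filter.atTop, 1 - η ≤ Literature.Probability.RandomGraphs.PlantedClique.typeIError T n + Literature.Probability.RandomGraphs.PlantedClique.typeIIError T k n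

/-- item stmt-PneNP-0423 · crux · rank 3 · open · by planner
why it might fail: Dies if ONE PPT test strongly detects a planted ⌈n^{1/2−ε}⌉-clique for ONE ε: spectral methods work from k ≥ c√n (AKS98 §2), only restricted classes (Metropolis, SQ, LS+, degree-d SoS for k ≤ n^{1/2−c√(d/log n)}) provably fail below √n, and no worst-case assumption implies it (BHKKMP16 §1).
sources: BarakHopkinsKelnerKothariMoitraPotechin2019, Jerrum1992, Kucera1995, AlonKrivelevichSudakov1998, FeigeKrauthgamer2003, arXiv:1201.1214
For every ε > 0, no randomized polynomial-time test φ satisfies Pr_{G∼G(n,1/2)∪K_S,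
|S|=⌈n^{1/2−ε}⌉}[φ(G) = 0] + Pr_{G∼G(n,1/2)}[φ(G) = 1] → 0. Stronger than the thesis (a recovery
algorithm plus a clique check is a test), and the form addressed by low-degree [arXiv:1907.11636],
SQ [arXiv:1201.1214, Thm 2.3–2.4] and SoS [arXiv:1604.03084, Thm 1.1] lower bounds. NEEDS
DEFINITION: plantedCliqueDist. NEEDS DEFINITION: plantedCliqueDist. [sources: arXiv:1604.03084;
arXiv:1201.1214; arXiv:1907.11636] [route PneNP/PlantedClique, rank 3] -/
@[route_item "route-PneNP-PlantedClique", crux]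
def PlantedcliqueDetectionHard : Prop :=
  ∀ ε : ℝ, 0 < ε → Literature.Probability.RandomGraphs.PlantedClique.PlantedCliqueDetectionHard (fun n : ℕ => ⌈(n : ℝ) ^ (1 / 2 - ε)⌉₊)

/-- item stmt-PneNP-8684 · crux · rank 3 · open · by planner
why it might fail: BBH18 Conj. 2.1: dies if ONE PPT test has advantage ↛ 0 at ONE admissible k ≤ n^{1/2−ε}; spectral/AKS need k ≥ c√n, only restricted classes (Metropolis, SQ Thms 2.8–2.9, LS+, degree-d SoS, low-degree) provably fail below √n, and no worst-case assumption is known to imply it (BHKKMP16 §1).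
sources: arXiv:1806.07508, BarakHopkinsKelnerKothariMoitraPotechin2019, Jerrum1992, Kucera1995, AlonKrivelevichSudakov1998, FeigeKrauthgamer2003
[crux] The Planted Clique conjecture in the form of Brennan–Bresler–Huleihel (arXiv:1806.07508,
Conjecture 2.1, PDF p. 11, at p = 1/2): for every clique-size sequence k with limsup log_n k(n) <
1/2 (here: ∃ ε > 0, k n ≤ n^{1/2−ε} eventually) and every probabilistic polynomial-time test T (one
machine for all n — weaker adversary than their sequence Aₙ), liminf_n (P_{G(n,1/2)}[T = 1] +
P_{G(n,1/2,k n)}[T = 0]) ≥ 1, i.e. ∀ η > 0 eventually typeIError T n + typeIIError T k n ≥ 1 − η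
(vocabulary of PlantedClique.lean). The operative crux of the route: it implies the search thesis
PlantedcliqueThesis (glue PlantedcliqueRecoveryGlue: a recovery algorithm plus a clique check is a
test with type-I → 0 by ErdosRenyiNoLargeClique) and, trivially, the strong-detection crux
PlantedcliqueDetectionHard; it follows from PlantedcliqueLowDegreePrediction +
PlantedcliqueLowDegreeNormOne. Small-k part is free: for k n ≤ (2−η)log₂ n the laws are contiguous
(second moment of clique counts), so the content is 2 log₂ n ≲ k ≤ n^{1/2−ε}. WHY IT MIGHT FAIL:
dies if ONE PPT test has advantage ↛ 0 for ONE admissible k — e.g. a degree-or-spectral statistic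
beating the √n threshold by any n^{ε}; spectral/AKS me -/
@[route_item "route-PneNP-PlantedClique"]
def PlantedcliqueIndistinguishable : Prop :=
  ∀ k : ℕ → ℕ, (∃ ε : ℝ, 0 < ε ∧ ∀ᶠ n : ℕ in Filter.atTop, (k n : ℝ) ≤ (n : ℝ) ^ (1 / 2 - ε)) → ∀ T : Literature.Computability.Complexity.RandAlg (List Bool) Bool, T.IsPolyTime id (fun b => [b]) → ∀ η : ℝ, 0 < η → ∀ᶠ n : ℕ in Filter.atTop, 1 - η ≤ Literature.Probability.RandomGraphs.PlantedClique.typeIError T n + Literature.Probability.RandomGraphs.PlantedClique.typeIIError T k n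

-- item stmt-PneNP-0422 · support · rank 2 · open · by planner — informal only, no Lean statement yet:
--   Most informative crux (the field's working conjecture, refutable in principle). Let (Pₙ, Qₙ) be a
--   sequence of detection problems with Qₙ = G(n,1/2) on edge-indicator vectors {±1}^{C(n,2)} and Pₙ a
--   planted distribution invariant under the vertex-permutation action of Sₙ, with likelihood ratio Lₙ =
--   dPₙ/dQₙ. If for some δ > 0 and D(n) = ⌈(log n)^{1+δ}⌉ the low-degree norm ‖Lₙ^{≤D}‖_{L²(Qₙ)}
--   (projection of Lₙ onto polynomials of degree ≤ D in the edge variables) is O(1), then no randomized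
--   polynomial-time test φₙ has Pₙ[φₙ = 0] + Qₙ[φₙ = 1] → 0. [Hopkins2018, Conj. 2.2.4 (bib key
--   missing); arXiv:1

/-- item stmt-PneNP-0425 · support · rank 4 · open · by planner
(thesis of route PlantedClique) → Literature.Computability.Cryptography.OWFExist. Sketch: f maps
(the C(n,2) − C(k,2) coin flips of G(n,1/2) outside S, an encoding of S) ↦ adjacency vector of
G(n,1/2) ∪ K_S; any inverter outputs some (coins', S') with the same graph, and S' is a k-clique,
hence S' = S w.p. → 1 (unique k-clique for k ≥ 3 log₂ n; cite fact); so the thesis says every PPT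
inverter succeeds with probability → 0 ≤ 1 − 1/2, i.e. f is weakly one-way, and weak ⇒ strong OWF by
Yao amplification (Literature.CryptoQuantFine, HastadImpagliazzoLevinLuby1999 context). Cf.
Juels–Peinado, Hiding cliques for cryptographic security, Des. Codes Cryptogr. 20 (2000) (bib key
missing). Links the route to MetaCplx (stmt-PneNP-0121). NEEDS DEFINITION: plantedCliqueDist;
conclusion typed. NEEDS DEFINITION: plantedCliqueDist. [sources: JuelsPeinado2000;
HastadImpagliazzoLevinLuby1999] [route PneNP/PlantedClique, rank 4] -/
@[route_item "route-PneNP-PlantedClique"]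
def PlantedcliqueImpliesOwf : Prop :=
  PlantedcliqueThesis → ∃ f : List Bool → List Bool, Literature.Computability.Complexity.PolyTimeComputable (id : List Bool → List Bool) (id : List Bool → List Bool) f ∧ ∀ A : Literature.Computability.Complexity.RandAlg (List Bool) (List Bool), A.IsPolyTime (id : List Bool → List Bool) (id : List Bool → List Bool) → Asymptotics.SuperpolynomialDecay Filter.atTop (fun n : ℕ => (n : ℝ)) (fun n : ℕ => (∑ x : List.Vector Bool n, A.pr id (Literature.Computability.Complexity.boolPair (Computability.unaryEncodeNat n) (f x.toList)) {z | f z = f x.toList}) / 2 ^ n)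

/-- item stmt-PneNP-0424 · support · rank 5 · open · by planner
Negation of the PlantedClique thesis, filed so the refuting side is staffed: ∃ ε > 0 and a
randomized poly-time A with limsup Pr[A(G(n,1/2) ∪ K_S) = S] > 0 for |S| = ⌈n^{1/2−ε}⌉. Record: k ≥
c√n for every fixed c > 0 in time n^{O(log(1/c))} (spectral; [AlonKrivelevichSudakov1998, Thm 1.1 +
§4 (bib key missing)]); nothing is known below √n·2^{-o(√log n)}-ish. Proving #5 closes the route.
NEEDS DEFINITION: plantedCliqueDist. NEEDS DEFINITION: plantedCliqueDist. [sources: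
AlonKrivelevichSudakov1998] [route PneNP/PlantedClique, rank 5] -/
@[route_item "route-PneNP-PlantedClique"]
def PlantedcliqueNegAlgorithm : Prop :=
  ∃ ε : ℝ, 0 < ε ∧ ¬ Literature.Probability.RandomGraphs.PlantedClique.PlantedCliqueRecoveryHard (fun n : ℕ => ⌈(n : ℝ) ^ (1 / 2 - ε)⌉₊)

/-- item stmt-PneNP-10556 · support · rank 9 · closed · proved by Summit.PneNP.PneNP.Theorems.plantedClique_detectionGlue_proof @ 7891d50b3baa (prover) · by planner
[support] Weak-detection hardness at every admissible clique-size sequence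
(PlantedcliqueIndistinguishable, BBH18 Conj. 2.1 form) gives strong-detection hardness at k_ε n =
⌈n^{1/2−ε}⌉₊ for every ε > 0 (PlantedcliqueDetectionHard, the premise of the route's deciding
theorem `closes`). Proof sketch (checked in the planner's Sketch.lean modulo admissibility): k_ε is
admissible with ε' = min(ε/2, 1/4), since ⌈n^{1/2−ε}⌉₊ ≤ n^{1/2−ε} + 1 ≤ n^{1/2−ε'} eventually (for
ε ≥ 1/2, k_ε n ≤ 1 ≤ n^{1/4}); then take η = 1/2: eventually typeIError T n + typeIIError T k_ε n ≥
1/2, so the error sum cannot tend to 0 (Filter.atTop on ℕ is NeBot; `(h1.and h2).exists` +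
linarith). Records the route DAG LowDegreePrediction ∧ LowDegreeNormOne → Indistinguishable →
DetectionHard → PneNP so that rank 3/rank 2 progress closes the `closes` premise mechanically.
[deps: PlantedcliqueIndistinguishable, PlantedcliqueDetectionHard] [difficulty: provable-now (S)]
[sources: arXiv:1806.07508 §2 (detection variants); BarakHopkinsKelnerKothariMoitraPotechin2019 §1
Rem. 2 (search vs decision)] -/
@[route_item "route-PneNP-PlantedClique"]
def PlantedcliqueDetectionGlue : Prop :=
  PlantedcliqueIndistinguishable → PlantedcliqueDetectionHard

/-- item stmt-PneNP-8685 · support · rank 9 · closed · proved by Summit.PneNP.PneNP.Theorems.plantedClique_plantedcliqueLowDegreeNormOne_proof @ 441e39a6a132 (prover) · by planner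
[support] The low-degree calculation for the FIXED-SIZE planted model (uniform k-subset,
plantedCliqueDist) in the whole window k n ≤ n^{1/2−ε}: for some δ > 0 (δ = 1/2 works) lowDegreeLRSq
(plantedCliqueDist n (k n)) ⌈(log n)^{1+δ}⌉ → 1. Port of the PROVED Bernoulli-model fact
hopkins_lowDegree_bounded_holds (PlantedCliqueLowDegreeProofs.lean): there E_μ χ_T = (−1)^{|T|}
q^{|V(T)|}; for the uniform k-subset S, Pr[V(T) ⊆ S] = (k)_t/(n)_t ≤ (k/n)^t (t = |V(T)|; = 0 for t
> k), so lowDegreeLRSq − 1 ≤ Σ_{t≥2} C(n,t)·cnt(t,D)·(k/n)^{2t} ≤ Σ_{t≥2} (k²/n)^t cnt(t,D)/t! with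
cnt(t,D) = #{{T ⊆ E(K_W) : V(T) = W, |T| ≤ D}} exactly as in that file
(lowDegreeLRSq_plantedBernoulliDist_le pattern). Degree raised from ⌊C log n⌋ to D = ⌈(log
n)^{1+δ}⌉, δ < 1: for t ≤ ε log₂ n use cnt ≤ 2^{t²} ≤ n^{εt}; for t > ε log₂ n use cnt ≤ (t²+1)^D ≤
(4D²+1)^D ≤ 2^{ε²(log₂ n)²} ≤ n^{εt} (eventually in n, uniformly in t ≤ 2D, since (log
n)^{1+δ}·log(4D²+1) = o(log² n)); hence lowDegreeLRSq − 1 ≤ Σ_{t≥2} n^{−εt}/t!·4^t → 0 (k ≤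
n^{1/2−ε} gives k²/n ≤ n^{−2ε}). Junk k (k n = 0, 1) gives norm exactly 1. Hopkins2018 Lemma 2.4.1
(D = C log n, Bernoulli planting); arXiv:2506.10748 Thm 1 p. 10 (binomial model: no w -/
@[route_item "route-PneNP-PlantedClique"]
def PlantedcliqueLowDegreeNormOne : Prop :=
  ∀ k : ℕ → ℕ, (∃ ε : ℝ, 0 < ε ∧ ∀ᶠ n : ℕ in Filter.atTop, (k n : ℝ) ≤ (n : ℝ) ^ (1 / 2 - ε)) → ∃ δ : ℝ, 0 < δ ∧ Filter.Tendsto (fun n : ℕ => Literature.Probability.RandomGraphs.LowDegree.lowDegreeLRSq (Literature.Probability.RandomGraphs.PlantedClique.plantedCliqueDist n (k n)) ⌈Real.log (n : ℝ) ^ (1 + δ)⌉₊) Filter.atTop (nhds 1)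

/-- item stmt-PneNP-8686 · support · rank 9 · closed · proved by Summit.PneNP.PneNP.Theorems.plantedClique_erdosRenyiNoLargeClique_proof @ 9495621fd5cb (prover) · by planner
[support] First-moment bound for the clique number of G(n,1/2) (Matula 1970/76; Grimmett–McDiarmid
1975; Bollobás–Erdős 1976; quoted in AlonKrivelevichSudakov1998 §1 and
BarakHopkinsKelnerKothariMoitraPotechin2019 Rem. 1.2: ω(G(n,1/2)) = (2+o(1)) log₂ n): if k(n) ≥
(2+η) log₂ n for all large n (some η > 0) then Pr[G(n,1/2) contains a k(n)-clique] ≤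
C(n,k)·2^{−C(k,2)} ≤ (n·2^{−(k−1)/2})^k → 0 (ENNReal-valued toOuterMeasure of erdosRenyiHalf,
graphOfEdgeVec of PlantedClique.lean; for k n > n the event is empty). Engine already in the tree:
toOuterMeasure_forall_eq_true_le in PlantedCliqueUnique.lean (Pr[all edges of a fixed edge set D
present] ≤ 2^{−|D|}) + union bound over the C(n,k) candidate sets. It is the type-I half of every
clique test in this route (PlantedcliqueRecoveryGlue, PlantedcliqueDetectionImpliesPneNP).
Difficulty: provable now (S/M). -/
@[route_item "route-PneNP-PlantedClique", crux]
def ErdosRenyiNoLargeClique : Prop :=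
  ∀ k : ℕ → ℕ, (∃ η : ℝ, 0 < η ∧ ∀ᶠ n : ℕ in Filter.atTop, (2 + η) * Real.logb 2 (n : ℝ) ≤ (k n : ℝ)) → Filter.Tendsto (fun n : ℕ => (Literature.Probability.RandomGraphs.PlantedClique.erdosRenyiHalf n).toOuterMeasure {x | ∃ S : Finset (Fin n), S.card = k n ∧ (Literature.Probability.RandomGraphs.PlantedClique.graphOfEdgeVec x).IsClique (S : Set (Fin n))}) Filter.atTop (nhds 0)

/-- item stmt-PneNP-8687 · support · rank 9 · closed · proved by Summit.PneNP.PneNP.Theorems.plantedClique_uniqueClique_proof @ 1bf50163990c (prover) · by planner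
[support] Uniqueness of the planted clique at k_ε = ⌈n^{1/2−ε}⌉, 0 < ε < 1/2: the planted set is the
unique maximum clique of G(n,1/2,k_ε) with probability → 1 (PlantedCliqueUniqueWhp of
PlantedClique.lean). Provable now from the tree's first-moment bound one_sub_le_uniqueMaxCliqueProb
(PlantedCliqueUnique.lean: failure ≤ n³·2^{−⌊(k−1)/2⌋} for 1 ≤ k ≤ n) exactly as
plantedCliqueUniqueWhp_of_sqrt_le does for k ≥ c√n: here k_ε = ⌈n^{1/2−ε}⌉ ≥ n^{c}, c = 1/2 − ε > 0,
so n³ 2^{−(k_ε−3)/2} → 0, and k_ε ≤ n eventually. Needed by the Assembly (sure inverter ⇒ recovery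
w.h.p.) and by PlantedcliqueImpliesOwf. Jerrum1992 §1, Kucera1995 §6 (uniqueness printed only for k
≥ C√(n log n)), AlonKrivelevichSudakov1998 §1. Difficulty: provable now (S). -/
@[route_item "route-PneNP-PlantedClique"]
def PlantedcliqueUniqueClique : Prop :=
  ∀ ε : ℝ, 0 < ε → ε < 1 / 2 → Literature.Probability.RandomGraphs.PlantedClique.PlantedCliqueUniqueWhp (fun n : ℕ => ⌈(n : ℝ) ^ (1 / 2 - ε)⌉₊)

/-- item stmt-PneNP-8688 · support · rank 9 · closed · proved by Summit.PneNP.PneNP.Theorems.plantedClique_indistinguishableGlue_proof @ 6c1d6fa63f27 (prover) · by planner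
[support] Glue, pure logic (checked in the planner's Sketch2.lean: `intro hP hN k hk; obtain ⟨δ, hδ,
hlim⟩ := hN k hk; exact hP k ⟨δ, hδ, hlim⟩`): the clique-family prediction at the window sequence
plus the norm-one calculation give the indistinguishability crux. Filed so that rank 3 closes
mechanically if rank 2 ever does. KuniskyWeinBandeira2019 (method). Difficulty: provable now. -/
@[route_item "route-PneNP-PlantedClique"]
def PlantedcliqueIndistinguishableGlue : Prop :=
  PlantedcliqueLowDegreePrediction → PlantedcliqueLowDegreeNormOne → PlantedcliqueIndistinguishable

/-- item stmt-PneNP-8689 · support · rank 9 · closed · proved by Summit.PneNP.PneNP.Theorems.plantedClique_plantedcliqueRecoveryGlue_proof @ b3d6a65da4b6 (prover) · by planner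
[support] Detection-to-recovery glue ('a recovery algorithm plus a clique check is a test'): assume
a PPT A recovers the planted ⌈n^{1/2−ε}⌉-clique with probability p_n ↛ 0 for some ε > 0. Let t(n) :=
(Nat.size n)² (any polynomial-time computable t with 3 log₂ n ≤ t(n) ≤ n^{1/2−ε} eventually); the
test T(1ⁿ, G) := [decodeVertexSet n (A(1ⁿ,G)) is a clique of G of size ≥ t(n)] is PPT (A's coins;
clique check and t(n) via the FP toolkit used for the AKS program, AKSProg.isClique/adj). Planted: T
accepts whenever A(G) = S (S is a k_ε-clique, k_ε ≥ t(n) eventually), so typeIIError ≤ 1 − p_n;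
null: acceptance forces a clique of size t(n) in G(n,1/2), so typeIError → 0 by
ErdosRenyiNoLargeClique (t(n) ≥ 3 log₂ n). PlantedcliqueIndistinguishable at k := k_ε (admissible
with ε/2: ⌈n^{1/2−ε}⌉ ≤ n^{1/2−ε/2} eventually) gives ∀ η, eventually typeI + typeII ≥ 1 − η, hence
p_n ≤ η + o(1) for every η: p_n → 0, contradiction. Corner ε ≥ 1/2 (k_ε = 1, not covered by the test
since 1 < t(n)): planting a singleton changes nothing, S is uniform and independent of G, so
recoverProb A k n ≤ 1/n → 0 directly. BarakHopkinsKelnerKothariMoitraPotechin2019 Rem. 1.2 (search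
vs decision); arXiv:1806.07508 §2. -/
@[route_item "route-PneNP-PlantedClique"]
def PlantedcliqueRecoveryGlue : Prop :=
  PlantedcliqueIndistinguishable → ErdosRenyiNoLargeClique → PlantedcliqueThesis

/-- item stmt-PneNP-8690 · assembly · rank 9 · closed · proved by Summit.PneNP.PneNP.Theorems.plantedClique_assembly2_proof @ 98ff67ebc15c (prover) · by planner
[support] The route's SECOND, shorter assembly, through the strong-detection crux: suppose ¬PneNP,
i.e. every L ∈ PNPWave0.NP Bool lies in PNPWave0.P Bool; by the proved bridges P_bool_eq_holds /
NP_bool_eq_holds (ClayProblem, ClayProblemProofs) Classes.NP ⊆ Classes.P. With t(n) := (Nat.size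
n)², the language {boolPair 1ⁿ (encodeEdgeVec x) : graphOfEdgeVec x has a clique of size t(n)} is in
NP (Karp1972; certificate = vertex list; verifier checks t(n) distinct pairwise-adjacent vertices
through the adjacency lookup AKSProg.adj of PlantedCliqueProgram.lean, realised in FP as for the AKS
program), hence in P, decided by a machine M, and T := RandAlg.ofDet M is a PPT test
(IsPolyTime.ofDet_holds). Type II: G ∼ G(n,1/2,⌈n^{1/4}⌉) contains its planted clique ⊇ a
t(n)-clique surely once t(n) ≤ n^{1/4} (mem_support_plantedCliqueJoint), so typeIIError T k n = 0
eventually; type I: typeIError T n = Pr[ω(G(n,1/2)) ≥ t(n)] → 0 by ErdosRenyiNoLargeClique. So typeI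
+ typeII → 0, contradicting PlantedcliqueDetectionHard at ε = 1/4. No search-to-decision, no
uniqueness needed. Karp1972; CookClay2006 §1; BarakHopkinsKelnerKothariMoitraPotechin2019 Rem. 1.2.
Difficulty: M (NP-membership plumbing). -/
@[route_item "route-PneNP-PlantedClique", crux]
def Assembly2 : Prop :=
  ErdosRenyiNoLargeClique → (∀ L : Language Bool, L ∈ Literature.Computability.Complexity.PNPWave0.NP Bool → L ∈ Literature.Computability.Complexity.PNPWave0.P Bool) → ¬ PlantedcliqueDetectionHard

-- records of items no longer active in this route (dropped / restated):
-- earlier Assembly (stmt-PneNP-0421, dropped 2026-08-16T14:43:06Z): moot by None — PlantedcliqueLowDegreePrediction → PlantedcliqueIndistinguishable → PlantedcliqueThesis → PneNP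

/-! D-0027 §2.1 — DECIDING THEOREM (planner-authored via `route open/edit --closes-file`; by planner-rbadge-PneNP-PlantedClique-b5009e6b-g2-0 2026-08-15T16:55:26Z):
its hypotheses are this route's items and its conclusion the sub-problem Statement (glue_lint), and it elaborates with this file. -/

@[closes "route-PneNP-PlantedClique"] theorem closes (hE : ErdosRenyiNoLargeClique) (hD : PlantedcliqueDetectionHard) (hA : Assembly2) : _root_.PneNP := by
  by_contra hne
  refine hA hE (fun L hL => ?_) hD
  by_contra hLP
  exact hne ⟨L, hL, hLP⟩

end Summit.PneNP.PneNP.Theses.PlantedClique
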